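import Mathlib
import HarnessLib
import Summits.HubbardSuperconductivity.HubbardSuperconductivity.Theorems.ComplexGFFStiffnessFreeHtLipschitz
import Literature.MathematicalPhysics.StatisticalMechanics.RenormalisationMapFreeHtSmooth

/-!
# Crux child `TwoKernelSkBound` (stmt-HubbardSuperconductivity-27414), line `banach_two_kernel`, stub `stub_f4l2ShrinkLoc` —
# block U1 proper: the UNIFORM `N`-free bound of `K_{k+1}` with a free intermediate Hamiltonian near the tied point

Route `route-HubbardSuperconductivity-ComplexGFFStiffness`; memo `Cruxes/HypACumulant/TWOKERNEL-PLAN-27414-v3.md` §2 (R1/R3).  For every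
[ABKM19] package `P` with `0 < P.r` there are `N`-FREE `M₁ ≥ 0`, `ρ₀ > 0` such that at every height, for `q` in the ball, every step
`k + 1 ≤ N`, every state `(u, v)` in the `P.r`-ball and every `H̃` with `‖H̃ − H̃_q‖_{k,0} ≤ ρ₀`:
`‖nextK(μ_q; e^{−toHam u}, e^{−H̃}, mulExt v)‖_{k+1}^{(A)} ≤ M₁`
— Theorem 6.8 on the ball (`weakNormLE_nextKStep_abkm_ball_of_stepKernelBounds`, `σ(r)·r`) plus the free-`H̃` Lipschitz bound
(`exists_weakNormLE_nextK_freeHt_sub`, `L₁ρ₀`).  This is the uniform bound (U1) that the line / bidisc Cauchy engines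
(`ComplexGFFStiffnessHolomorphicFreeHtEngines`) consume for block B1.  All proved, no `sorry`.  Honest scope: rung route (stiffness of a
complex Gaussian gradient field via the [ABKM19] RG); nothing about superconductivity in the Hubbard model.

## References
* S. Adams, S. Buchholz, R. Kotecký, S. Müller, arXiv:1910.13564, Theorem 6.8, Ch. 12 (12.4), Lemma 12.6 (12.53)
  [AdamsBuchholzKoteckyMuller2019].
-/

noncomputable section

-- `Summit.<Summit>.<Problem>`: single-conjunct summit, the duplicate component is mandated (D-0017).
set_option linter.dupNamespace false

namespace Summit.HubbardSuperconductivity.HubbardSuperconductivity.Theorems.ComplexGFF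

open scoped BigOperators Classical
open Finset MeasureTheory
open Literature.MathematicalPhysics.StatisticalMechanics.GradientRG
open Literature.MathematicalPhysics.StatisticalMechanics.TorusPolymer
  (IsPolymer blocks polys bprod blockOf thicken reblock boxCorner mem_polys mem_blocks numBlocks isPolymer_blockOf
    card_blocks_eq_numBlocks blocks_blockOf empty_mem_polys closure mem_blockOf_self)
open Literature.Barriers.CriticalPhenomena.LongRangePhi4.Polymer (IsConn components)
open Literature.MathematicalPhysics.QuantumFieldTheory

variable {d : ℕ}

set_option maxHeartbeats 800000 in
/-- **Block U1: uniform `N`-free bound of `K_{k+1}` with a free intermediate Hamiltonian on a ball around the tied point**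
(module docstring). [cite: AdamsBuchholzKoteckyMuller2019, Theorem 6.8 / Lemma 12.6 (12.53)] -/
theorem exists_weakNormLE_nextK_freeHt_ball (P : PackageData d) [Fact (0 < P.h)] [Fact (0 < P.L)] (hr0 : 0 < P.r) :
    ∃ M₁ ρ₀ : ℝ, 0 ≤ M₁ ∧ 0 < ρ₀ ∧ ∀ (N M : ℕ) [NeZero M] (Q : PackageAt P N M),
      ∀ q : Matrix (Fin d) (Fin d) ℝ, P.InBall q → ∀ k, k + 1 ≤ N →
      ∀ (u : HamSpace ℂ d (fieldWt P.h (P.L : ℝ) d k) ((P.L : ℝ) ^ k) (P.L ^ (d * k)))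
        (v : activitySpace Q.normParams k) (cv : ℝ), ‖u‖ ≤ P.r →
        activityNormLE Q.normParams k v cv → cv ≤ P.r →
      ∀ Ht : RelevantHamiltonian ℂ d,
        hamNorm (fieldWt P.h (P.L : ℝ) d k) ((P.L : ℝ) ^ k) (P.L ^ (d * k))
          (Ht - nextH (abkmStepData P.L P.R k (Q.kernels q)) (HamSpace.toHam u)
            (mulExt ((v : activitySpace Q.normParams k) :
              Finset (Fin d → ZMod M) → ((Fin d → ZMod M) → ℝ) → ℂ))) ≤ ρ₀ →
        WeakNormLE Q.normParams (k + 1)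
          (fun U φ =>
            nextK (abkmStepData P.L P.R k (Q.kernels q)).s
                (reblock (abkmStepData P.L P.R k (Q.kernels q)).s
                  ((abkmStepData P.L P.R k (Q.kernels q)).L * (abkmStepData P.L P.R k (Q.kernels q)).s))
                (stepMeasure (abkmStepData P.L P.R k (Q.kernels q)).𝒞) (expNegH (HamSpace.toHam u)) (expNegH Ht)
                (mulExt ((v : activitySpace Q.normParams k) :
                  Finset (Fin d → ZMod M) → ((Fin d → ZMod M) → ℝ) → ℂ)) U φ)
          M₁ := by
  obtain ⟨L₁, ρ₀, hL₁, hρ₀, hLip⟩ := exists_weakNormLE_nextK_freeHt_sub P hr0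
  have hσ0 : 0 ≤ sigmaABKM d P.L P.R P.A P.A𝒫' P.r := sigmaABKM_nonneg P.hLodd.pos P.hA1 P.A𝒫'_nonneg P.hr0
  refine ⟨L₁ * ρ₀ + sigmaABKM d P.L P.R P.A P.A𝒫' P.r * P.r, ρ₀, by positivity, hρ₀, fun N M _ Q => ?_⟩
  intro q hq k hk u v cv hu hv hcv Ht hHt
  have hPA : 0 < Q.normParams.A := P.A_pos
  have hk1 : 1 ≤ P.L ^ k := Nat.one_le_pow _ _ P.hLodd.pos
  have hMt : M = Q.normParams.L ^ k * P.L ^ (N - k) := by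
    show M = P.L ^ k * P.L ^ (N - k)
    rw [Q.hM, ← pow_add, Nat.add_sub_cancel' (by omega)]
  have hcv0 : 0 ≤ cv := nonneg_of_weakNormLE hPA hMt P.hLodd.pow P.hLodd.pow hv
  set H := HamSpace.toHam u with hHdef
  set Kf := mulExt ((v : activitySpace Q.normParams k) :
    Finset (Fin d → ZMod M) → ((Fin d → ZMod M) → ℝ) → ℂ) with hKfdef
  have hnormu : hamNorm (fieldWt P.h (P.L : ℝ) d k) ((P.L : ℝ) ^ k) (P.L ^ (d * k)) H = ‖u‖ := by
    rw [hHdef, HamSpace.norm_def]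
  have hHr : hamNorm (fieldWt P.h (P.L : ℝ) d k) ((P.L : ℝ) ^ k) (P.L ^ (d * k)) H ≤ P.r := by rw [hnormu]; exact hu
  have hH8 : hamNorm (fieldWt P.h (P.L : ℝ) d k) ((P.L : ℝ) ^ k) (P.L ^ (d * k)) H ≤ 1 / 8 :=
    hHr.trans (P.hr.trans (by norm_num))
  have hKw : WeakNormLE Q.normParams k Kf cv := activitySpace.weakNormLE_mulExt v hv
  have hKr : WeakNormLE Q.normParams k Kf P.r := hKw.mono hPA hcv
  have hKd : ∀ Y, ContDiff ℝ P.r₀ (Kf Y) := activitySpace.contDiff_mulExt v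
  have hKloc : ∀ Y, IsPolymer (P.L ^ k) Y → IsConn Y → IsGaugeLocal (Q.normParams.gauge k Y) (Kf Y) :=
    fun Y hY hYc => activitySpace.isGaugeLocal_mulExt v hY hYc
  have hKt : TransInv (P.L ^ k) Kf := activitySpace.transInv_mulExt v
  have hSa := packageAt_stepKernelBounds P Q hq hk
  set Da := abkmStepData P.L P.R k (Q.kernels q) with hDa
  -- the Lipschitz part and Theorem 6.8 on the ball
  have h1 := hLip N M Q q hq k hk u v cv hu hv hcv Ht hHt
  have h2 := weakNormLE_nextKStep_abkm_ball_of_stepKernelBounds P.hd P.hLodd P.hL P.hR2 Q.hM hk P.hp P.hpM P.hMR P.hr₀ Q.hB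
    P.hδ₀ P.hδ₁ P.hh P.hh0 P.hh2 P.A𝒫'_nonneg P.hA1 P.hA𝒫A P.hsmall Da rfl rfl hSa (x₀ := 0) rfl rfl hHr P.hr hKr
    (factorises_mulExt hk1) (fun φ => mulExt_empty φ) hKd hKloc hKt P.hv P.hωA P.hc3A P.hc2A
  -- smoothness of both functionals
  have hc1 : ∀ X, ContDiff ℝ Q.normParams.r₀ ((fun U φ =>
      nextK Da.s (reblock Da.s (Da.L * Da.s)) (stepMeasure Da.𝒞) (expNegH H) (expNegH Ht) Kf U φ - nextKStep Da H Kf U φ) X) := by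
    intro X
    have ha := contDiff_nextK_freeHt_abkm_of_stepKernelBounds P.hd P.hLodd P.hL Q.hM hk P.hp P.hpM P.hMR Q.hB P.hδ₀ P.hδ₁
      P.hh P.hh0 P.hA1 Da rfl rfl hSa (x₀ := 0) rfl rfl hH8 Ht P.hr0 hKr (factorises_mulExt hk1) (fun φ => mulExt_empty φ)
      hKd hKloc X
    have hb := contDiff_nextKStep_abkm_of_stepKernelBounds P.hd P.hLodd P.hL Q.hM hk P.hp P.hpM P.hMR Q.hB P.hδ₀ P.hδ₁
      P.hh P.hh0 P.hA1 Da rfl rfl hSa (x₀ := 0) rfl rfl hH8 P.hr0 hKr (factorises_mulExt hk1) (fun φ => mulExt_empty φ)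
      hKd hKloc X
    exact ha.sub hb
  have hc2 : ∀ X, ContDiff ℝ Q.normParams.r₀ (nextKStep Da H Kf X) := fun X =>
    contDiff_nextKStep_abkm_of_stepKernelBounds P.hd P.hLodd P.hL Q.hM hk P.hp P.hpM P.hMR Q.hB P.hδ₀ P.hδ₁
      P.hh P.hh0 P.hA1 Da rfl rfl hSa (x₀ := 0) rfl rfl hH8 P.hr0 hKr (factorises_mulExt hk1) (fun φ => mulExt_empty φ)
      hKd hKloc X
  have hsum := h1.add h2 hc1 hc2
  have hfun : (fun X => (fun U φ =>
      nextK Da.s (reblock Da.s (Da.L * Da.s)) (stepMeasure Da.𝒞) (expNegH H) (expNegH Ht) Kf U φ - nextKStep Da H Kf U φ) X +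
        nextKStep Da H Kf X) =
      (fun U φ => nextK Da.s (reblock Da.s (Da.L * Da.s)) (stepMeasure Da.𝒞) (expNegH H) (expNegH Ht) Kf U φ) := by
    funext X φ
    simp only [Pi.add_apply, sub_add_cancel]
  rw [hfun] at hsum
  refine hsum.mono hPA ?_
  have hδρ := hHt
  have : L₁ * hamNorm (fieldWt P.h (P.L : ℝ) d k) ((P.L : ℝ) ^ k) (P.L ^ (d * k)) (Ht - nextH Da H Kf) ≤ L₁ * ρ₀ :=
    mul_le_mul_of_nonneg_left hδρ hL₁
  linarith

end Summit.HubbardSuperconductivity.HubbardSuperconductivity.Theorems.ComplexGFF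

end
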